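import Summits.QuantumFields.BalabanUV.Beta.GAN24.CombLin4Transport
import Summits.QuantumFields.BalabanUV.Beta.GAN24.PsiTableDefectOfDivergences
import Summits.QuantumFields.BalabanUV.Beta.GAN24.HalfMemberCellOfDivergences
import Summits.QuantumFields.BalabanUV.Beta.GAN24.Lin4ZeroMode
import Summits.QuantumFields.BalabanUV.Beta.CombChartTransportLevel
import Summits.QuantumFields.BalabanUV.Beta.FP.PackedLegCombSym

/-!
# `BalabanUV.Beta.GAN24.CombHalfMemberCellOfDivergences` — binder row G-an2-4 ∕ (CONV-C), W-slot, TRANSFER-III: **(C-6) THE COMB-CHART CELLS FROM THE FOUR DIVERGENCE LETTERS** —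
# the (III′) twin of MY g66 `HalfMemberCellOfDivergences.cell_rows_of_divergence_rows`: for ANY family of bi-tables `Z l` with the FOUR single-divergence letter rows, the cells
# `𝒜^{G′}_l Z_l − 𝒜^{K}_l Z_l` of the OWNER gan24-p1 g46's (III′) L8a ∕ L8c (`CombAffineUnrollProjected` ∕ `CombT2ShapeEvenEnd`), `G′_l = GcombSh Lc l`, `K_l = KInvStep Lc l`, are `LocStencil₂`
# UNIFORMLY IN `l` — composed BY NAME from an2's `CombChartTransportLevel.GcombSh_eq_conj_psiKS_KInvStep` (`G′ = Ψ̂_S Ĝ^c Ψ̂_Sᵀ`), `CombLin4Transport` ((C-1) `lin4_conj_psiKS`,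
# `unitK_conj_psiKS`), `PsiTableDefectOfDivergences.locStencil₂_psiTable_sub_self_of_divergence_rows` (the four-variable Ψ-defect), leaf-04∕-10's `Lin4ZeroMode.locStencil₂_lin4`, and the
# (E) cell AT THE CENTRED ROOT (MY g66 `cell_rows_of_divergence_rows (hr := ctrOff_mem_box)`; leaf-06's `TableDressingDefect` inside).

NOT IN PRINT; OUR BOOKKEEPING (G-an2-4 crux team (2), leaf prover `b2b-balaban-gan24-formalise-leaf-03`, gen 79).  [folklore] composition BY NAME; 0 `def`, 0 cited facts, 0 `def … : Prop`, 0 sorry.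
DISPLAYED — EXACTLY the rows of MY g66 (E) cell theorem, nothing more: the undressed unit K-rows `hK` (road P1's `KSlotAssembly.convCKWall_holds` at `d = 3`; uniform decay only),
the tables' shapes `hZ`, and the four letter rows `h₂ h₁ hL₁ hL₂` (MY g66 binders VERBATIM).  NO dressed-kernel row: the Ψ-part `𝒜^{Ĝ^c}_l (𝒯₄ Z_l − Z_l)` is moved onto the
UNDRESSED unit step kernel by leaf-06's (E) identity `LinT2CoDressedStep.lin4_unitK_coDressKBmAt` (`𝒜^{Ĝ^c}_l X = 𝒜^{K}_l (𝔇 X)`) and `TableDressingDefect.locStencil₂_tableDress`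
(`𝔇` preserves `LocStencil₂`, `l`-free factor); the class `Spr` of `unitK_l Ĝ^c_l` (needed only to state the transport identities) is asym1's `decays_coDressKBmAt_KInvStep`.
HONEST DEPENDENCY (verbatim): «continuum YM on T⁴ ⇐ BetaPertH ∧ nine spine estimates (0/9 proved); BetaPertH ⇐ (D1) ∧ (D4) ∧ CAP+tail; G-an2-4 gates asym, D1 and NE2/3/4.»
WHAT THIS IS NOT: NOT the letter rows at the comb data (the campaign's bill, the OWNER's W-4 (3)), NOT the drift cells (the eight-row version — the same composition on differences, next),
NOT a value; the (III′) campaign is NOT asked (an2 W-4); zero weight; NEVER «G-an2-4 closed» as (CONV-C); NOT D1, NOT `BetaPertH`, NOT continuum, NOT Clay.  2026-08-25.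
-/

noncomputable section

open Finset
open scoped BigOperators
open Literature.MathematicalPhysics.QuantumFieldTheory
open Literature.MathematicalPhysics.QuantumFieldTheory.Balaban1983to89
open Literature.MathematicalPhysics.QuantumFieldTheory.Balaban1983to89.Beta
open ExpKernelCalculus (MKer Site BiLoc Decays comp)
open OneStepResolventKernel (Fib LocStencil decays_mono)
open OneStepKernelFamily (KInvStep decays_KInvStep)
open KernelWard (divV)
open AffineAveraging (box unitVec toSite)
open AveragingContoursRooted (ctr ctrOff ctrOff_mem_box)
open BalabanCompositeJets (LocStencil₂)
open BalabanStepW2 (locStencil₂_add')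
open SecondOrderResponse (cBi)
open Summit.QuantumFields.BalabanUV.Beta.TameKernelCalculus
open Summit.QuantumFields.BalabanUV.Beta.HessKerDressedUnits (unitK decays_unitK)
open Summit.QuantumFields.BalabanUV.Beta.AxialDressingRooted (coDressKBmAt dressKBmAt coProjBmAtK decays_coDressKBmAt_KInvStep one_le_of_neZero)
open Summit.QuantumFields.BalabanUV.Beta.SymCorrectorKernel (psiKS)
open Summit.QuantumFields.BalabanUV.Beta.SymCorrectorFace (slotPsiS faceWtSum)
open Summit.QuantumFields.BalabanUV.Beta.SecondOrderRemainderTables (abs_le_of_locStencil₂)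
open Summit.QuantumFields.BalabanUV.Beta.CombChartStepJets (GcombSh)
open Summit.QuantumFields.BalabanUV.Beta.CombChartTransportLevel (GcombSh_eq_conj_psiKS_KInvStep)
open Summit.QuantumFields.BalabanUV.Beta.GAN24.CombesThomas (sfStep smStep sfStep_ne_zero smStep_ne_zero)
open Summit.QuantumFields.BalabanUV.Beta.GAN24.LinT2CoDressedStep (lin4_unitK_coDressKBmAt)
open Summit.QuantumFields.BalabanUV.Beta.GAN24.TableDressingDefect (locStencil₂_tableDress locStencil₂_tableDress_sub_self lin4_comb_coDressKBmAt_sub)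
open Summit.QuantumFields.BalabanUV.Beta.GAN24.DressingDefectOfDivergences (locStencil₂_tableDress_sub_self_of_divergences)
open Summit.QuantumFields.BalabanUV.Beta.GAN24.T2RecursionAffine (lin4)
open Summit.QuantumFields.BalabanUV.Beta.GAN24.BiStencilZeroMode (Tab)
open Summit.QuantumFields.BalabanUV.Beta.GAN24.Lin4Additive (lin4_sub lin4_add)
open Summit.QuantumFields.BalabanUV.Beta.GAN24.Lin4ZeroMode (locStencil₂_lin4)
open Summit.QuantumFields.BalabanUV.Beta.GAN24.CombLin4Transport (lin4_conj_psiKS lin4_conj_psiKS' unitK_conj_psiKS)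
open Summit.QuantumFields.BalabanUV.Beta.GAN24.PsiTableDefectOfDivergences (locStencil₂_psiTable_sub_self_of_divergence_rows)

namespace Summit.QuantumFields.BalabanUV.Beta.GAN24.CombHalfMemberCellOfDivergences

variable {d : ℕ} {Lc : ℕ} [NeZero Lc]

/-! ## §1 Three small bookkeeping lemmas (shapes ⇒ the uniform bounds leaf-01's `lin4_add ∕ lin4_sub` want) -/

/-- Shape of a table from the shape of its defect against another table and the shape of that table (same rate; constants add). -/
theorem locStencil₂_of_sub {X Y : Tab d} {CD CY m : ℝ}
    (hD : LocStencil₂ (fun κ u κ' u' => X κ u κ' u' - Y κ u κ' u') CD m) (hY : LocStencil₂ Y CY m) :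
    LocStencil₂ X (CD + CY) m := by
  have h := locStencil₂_add' hD hY
  have e : (fun κ u κ' u' => X κ u κ' u' - Y κ u κ' u' + Y κ u κ' u') = X := by
    funext κ u κ' u'
    simp only [sub_add_cancel]
  rw [e] at h
  exact h

/-- `lin4` of a difference of two `LocStencil₂` tables is the difference of the `lin4`'s (leaf-01's `lin4_sub` with the uniform bounds read off the shapes). -/
theorem lin4_sub_of_locStencil₂ {K : MKer (d + 1) (Fib d)} {C δ : ℝ} (hK : Decays K C δ) (hδ : 0 < δ) (c : ℝ) (N : ℕ)
    {T T' : Tab d} {B m B' m' : ℝ} (hT : LocStencil₂ T B m) (hm : 0 ≤ m) (hT' : LocStencil₂ T' B' m') (hm' : 0 ≤ m') :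
    lin4 c K N (T - T') = lin4 c K N T - lin4 c K N T' :=
  lin4_sub hK hδ c N (B := max B B')
    (fun κ u κ' u' x z a b => (abs_le_of_locStencil₂ hT hm κ u κ' u' x z a b).trans (le_max_left B B'))
    (fun κ u κ' u' x z a b => (abs_le_of_locStencil₂ hT' hm' κ u κ' u' x z a b).trans (le_max_right B B'))

/-- `lin4` of a sum of two `LocStencil₂` tables is the sum of the `lin4`'s (leaf-01's `lin4_add` with the uniform bounds read off the shapes). -/
theorem lin4_add_of_locStencil₂ {K : MKer (d + 1) (Fib d)} {C δ : ℝ} (hK : Decays K C δ) (hδ : 0 < δ) (c : ℝ) (N : ℕ)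
    {T T' : Tab d} {B m B' m' : ℝ} (hT : LocStencil₂ T B m) (hm : 0 ≤ m) (hT' : LocStencil₂ T' B' m') (hm' : 0 ≤ m') :
    lin4 c K N (T + T') = lin4 c K N T + lin4 c K N T' :=
  lin4_add hK hδ c N (B := max B B')
    (fun κ u κ' u' x z a b => (abs_le_of_locStencil₂ hT hm κ u κ' u' x z a b).trans (le_max_left B B'))
    (fun κ u κ' u' x z a b => (abs_le_of_locStencil₂ hT' hm' κ u κ' u' x z a b).trans (le_max_right B B'))

/-! ## §2 The comb cell IS one undressed `lin4` of the COMB DEFECT TABLE `𝔇 (𝒯₄ Z − Z) + (𝔇 Z − Z)` -/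

/-- NOT IN PRINT; OUR BOOKKEEPING.  **THE COMB-CHART CELL IS ONE UNDRESSED `lin4` OF THE COMB DEFECT TABLE** (generic `d`, `2 ≤ Lc`, any level `l`, any `c`, ANY bi-table
`Z` with SOME `LocStencil₂` shape and SOME shape of its four-variable Ψ-defect `𝒯₄ Z − Z` — both enter only as summability ∕ boundedness, the identity is constant-free):
`𝒜^{G′}_l Z − 𝒜^{K}_l Z = 𝒜^{K}_l (𝔇 (𝒯₄ Z − Z) + (𝔇 Z − Z))`, `G′_l = unitK_l (GcombSh Lc l)`, `K_l = unitK_l (KInvStep Lc l)`, `𝒯₄ Z = Ψ̂ᵀ ∘ 𝒯₂ Z ∘ Ψ̂` (root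
`ctrOff`), `𝔇` = leaf-06's table dressing at the centred root `ctr (d+1) Lc`.  Route: an2's `GcombSh_eq_conj_psiKS_KInvStep` ⨾ (C-1) `unitK_conj_psiKS ∕ lin4_conj_psiKS'`
(`𝒜^{G′} Z = 𝒜^{Ĝ^c} (𝒯₄ Z)`) ⨾ leaf-01's `lin4_sub` ⨾ leaf-06's `lin4_unitK_coDressKBmAt` (`𝒜^{Ĝ^c} X = 𝒜^{K} (𝔇 X)`) and `lin4_comb_coDressKBmAt_sub` (the (E) cell
`𝒜^{Ĝ^c} Z − 𝒜^{K} Z = 𝒜^{K} (𝔇 Z − Z)`) ⨾ leaf-01's `lin4_add`.  The class of `unitK_l Ĝ^c_l` is asym1's `decays_coDressKBmAt_KInvStep` (SOME constants). -/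
theorem comb_cell_eq_lin4_combDefect (hLc : 2 ≤ Lc) (c : ℝ) (l : ℕ) {Z : Tab d} {CZ δZ : ℝ} (hZ : LocStencil₂ Z CZ δZ) (hδZ : 0 < δZ)
    {CD δD : ℝ} (hD : LocStencil₂ (fun κ u κ' u' =>
      comp (trK (psiKS (ctrOff (d + 1) Lc) Lc)) (comp (slotPsiS (ctrOff (d + 1) Lc) Lc (slotPsiS (ctrOff (d + 1) Lc) Lc Z κ u) κ' u') (psiKS (ctrOff (d + 1) Lc) Lc))
        - Z κ u κ' u') CD δD) (hδD : 0 < δD) :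
    lin4 c (unitK (sfStep Lc l) (smStep d Lc l) (GcombSh (d := d) Lc l)) Lc Z
        - lin4 c (unitK (sfStep Lc l) (smStep d Lc l) (KInvStep (d := d) Lc l)) Lc Z
      = lin4 c (unitK (sfStep Lc l) (smStep d Lc l) (KInvStep (d := d) Lc l)) Lc
          ((fun κ u κ' u' => dressKBmAt (ctr (d + 1) Lc) Lc (coProjBmAtK (ctr (d + 1) Lc) Lc (fun κ₁ u₁ => coProjBmAtK (ctr (d + 1) Lc) Lc
              ((fun κ u κ' u' => comp (trK (psiKS (ctrOff (d + 1) Lc) Lc))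
                  (comp (slotPsiS (ctrOff (d + 1) Lc) Lc (slotPsiS (ctrOff (d + 1) Lc) Lc Z κ u) κ' u') (psiKS (ctrOff (d + 1) Lc) Lc)) - Z κ u κ' u') κ₁ u₁) κ' u') κ u))
            + ((fun κ u κ' u' => dressKBmAt (ctr (d + 1) Lc) Lc (coProjBmAtK (ctr (d + 1) Lc) Lc (fun κ₁ u₁ => coProjBmAtK (ctr (d + 1) Lc) Lc (Z κ₁ u₁) κ' u') κ u))
                - Z)) := by
  have hLc1 : 1 ≤ Lc := le_trans (by norm_num) hLc
  have hLc0 : 0 < Lc := hLc1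
  have hr : ctrOff (d + 1) Lc ∈ box (d + 1) Lc := ctrOff_mem_box hLc1
  have hm0 : 0 < min δD δZ := lt_min hδD hδZ
  -- the transported table itself is `LocStencil₂` (defect + table, at the smaller rate)
  have hT4 := locStencil₂_of_sub (hD.mono (min_le_left δD δZ)) (hZ.mono (min_le_right δD δZ))
  -- the centred-root dressed unit kernel and the undressed unit kernel decay (SOME constants; only their classes are used)
  obtain ⟨δG, CG, hδG, -, hGr⟩ := decays_coDressKBmAt_KInvStep (d := d) (Lc := Lc) (r := ctrOff (d + 1) Lc) hr l
  have hG : Decays (unitK (sfStep Lc l) (smStep d Lc l) (coDressKBmAt (ctr (d + 1) Lc) Lc (KInvStep (d := d) Lc l))) _ δG := decays_unitK hGr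
  have hKu : Spr (unitK (sfStep Lc l) (smStep d Lc l) (coDressKBmAt (ctr (d + 1) Lc) Lc (KInvStep (d := d) Lc l))) := ⟨_, δG, hδG, hG⟩
  obtain ⟨δ₀, C₀, hδ₀, hC₀, hKr⟩ := decays_KInvStep (d := d) (Lc := Lc) l
  have hKl : Decays (unitK (sfStep Lc l) (smStep d Lc l) (KInvStep (d := d) Lc l)) _ δ₀ := decays_unitK hKr
  -- (i) `unitK_l (GcombSh Lc l) = Ψ̂ ∘ unitK_l Ĝ^c_l ∘ Ψ̂ᵀ`, so `𝒜^{G′} Z = 𝒜^{Ĝ^c} (𝒯₄ Z)` and the Ψ-part of the cell is `𝒜^{Ĝ^c} (𝒯₄ Z − Z)`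
  have eG : unitK (sfStep Lc l) (smStep d Lc l) (GcombSh (d := d) Lc l)
      = comp (comp (psiKS (ctrOff (d + 1) Lc) Lc) (unitK (sfStep Lc l) (smStep d Lc l) (coDressKBmAt (ctr (d + 1) Lc) Lc (KInvStep (d := d) Lc l))))
          (trK (psiKS (ctrOff (d + 1) Lc) Lc)) := by
    rw [GcombSh_eq_conj_psiKS_KInvStep Lc l, unitK_conj_psiKS]
  have eL : lin4 c (unitK (sfStep Lc l) (smStep d Lc l) (GcombSh (d := d) Lc l)) Lc Z
      = lin4 c (unitK (sfStep Lc l) (smStep d Lc l) (coDressKBmAt (ctr (d + 1) Lc) Lc (KInvStep (d := d) Lc l))) Lc (fun κ u κ' u' =>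
          comp (trK (psiKS (ctrOff (d + 1) Lc) Lc)) (comp (slotPsiS (ctrOff (d + 1) Lc) Lc (slotPsiS (ctrOff (d + 1) Lc) Lc Z κ u) κ' u') (psiKS (ctrOff (d + 1) Lc) Lc))) := by
    funext κ u κ' u'
    rw [eG]
    exact lin4_conj_psiKS' hLc0 hr hKu hZ hδZ c κ u κ' u'
  have eCell : lin4 c (unitK (sfStep Lc l) (smStep d Lc l) (GcombSh (d := d) Lc l)) Lc Z
        - lin4 c (unitK (sfStep Lc l) (smStep d Lc l) (coDressKBmAt (ctr (d + 1) Lc) Lc (KInvStep (d := d) Lc l))) Lc Z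
      = lin4 c (unitK (sfStep Lc l) (smStep d Lc l) (coDressKBmAt (ctr (d + 1) Lc) Lc (KInvStep (d := d) Lc l))) Lc (fun κ u κ' u' =>
          comp (trK (psiKS (ctrOff (d + 1) Lc) Lc)) (comp (slotPsiS (ctrOff (d + 1) Lc) Lc (slotPsiS (ctrOff (d + 1) Lc) Lc Z κ u) κ' u') (psiKS (ctrOff (d + 1) Lc) Lc))
            - Z κ u κ' u') := by
    rw [eL, ← lin4_sub_of_locStencil₂ hG hδG c Lc hT4 hm0.le hZ hδZ.le]
    rfl
  -- (ii) co-dressing the resolvent is dressing the table (leaf-06's (E) identity): the Ψ-part rides on the UNDRESSED unit step kernel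
  have eA : lin4 c (unitK (sfStep Lc l) (smStep d Lc l) (coDressKBmAt (ctr (d + 1) Lc) Lc (KInvStep (d := d) Lc l))) Lc (fun κ u κ' u' =>
          comp (trK (psiKS (ctrOff (d + 1) Lc) Lc)) (comp (slotPsiS (ctrOff (d + 1) Lc) Lc (slotPsiS (ctrOff (d + 1) Lc) Lc Z κ u) κ' u') (psiKS (ctrOff (d + 1) Lc) Lc))
            - Z κ u κ' u')
      = lin4 c (unitK (sfStep Lc l) (smStep d Lc l) (KInvStep (d := d) Lc l)) Lc (fun κ u κ' u' => dressKBmAt (ctr (d + 1) Lc) Lc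
          (coProjBmAtK (ctr (d + 1) Lc) Lc (fun κ₁ u₁ => coProjBmAtK (ctr (d + 1) Lc) Lc ((fun κ u κ' u' =>
            comp (trK (psiKS (ctrOff (d + 1) Lc) Lc)) (comp (slotPsiS (ctrOff (d + 1) Lc) Lc (slotPsiS (ctrOff (d + 1) Lc) Lc Z κ u) κ' u') (psiKS (ctrOff (d + 1) Lc) Lc))
              - Z κ u κ' u') κ₁ u₁) κ' u') κ u)) := by
    have hm₀ : 0 < min δ₀ δD := lt_min hδ₀ hδD
    exact lin4_unitK_coDressKBmAt hLc1 hr (decays_mono hKr hC₀ le_rfl (min_le_left δ₀ δD)) hm₀ (sfStep_ne_zero l) (smStep_ne_zero l)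
      (hD.mono (min_le_right δ₀ δD)) c
  -- (iii) the (E) cell at the centred root (leaf-06): `𝒜^{Ĝ^c} Z − 𝒜^{K} Z = 𝒜^{K} (𝔇 Z − Z)`
  have eE : lin4 c (unitK (sfStep Lc l) (smStep d Lc l) (coDressKBmAt (ctr (d + 1) Lc) Lc (KInvStep (d := d) Lc l))) Lc Z
        - lin4 c (unitK (sfStep Lc l) (smStep d Lc l) (KInvStep (d := d) Lc l)) Lc Z
      = lin4 c (unitK (sfStep Lc l) (smStep d Lc l) (KInvStep (d := d) Lc l)) Lc
          ((fun κ u κ' u' => dressKBmAt (ctr (d + 1) Lc) Lc (coProjBmAtK (ctr (d + 1) Lc) Lc (fun κ₁ u₁ => coProjBmAtK (ctr (d + 1) Lc) Lc (Z κ₁ u₁) κ' u') κ u))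
            - Z) :=
    lin4_comb_coDressKBmAt_sub hr l hZ hδZ c
  -- (iv) split, rewrite, and re-join (leaf-01's `lin4_add` with the bounds read off the shapes of `𝔇 (𝒯₄ Z − Z)` and `𝔇 Z − Z`)
  have hDD := locStencil₂_tableDress hLc1 hr hD hδD.le
  have hEZ := locStencil₂_tableDress_sub_self hLc1 hr hZ hδZ.le
  have e : lin4 c (unitK (sfStep Lc l) (smStep d Lc l) (GcombSh (d := d) Lc l)) Lc Z - lin4 c (unitK (sfStep Lc l) (smStep d Lc l) (KInvStep (d := d) Lc l)) Lc Z
      = (lin4 c (unitK (sfStep Lc l) (smStep d Lc l) (GcombSh (d := d) Lc l)) Lc Z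
          - lin4 c (unitK (sfStep Lc l) (smStep d Lc l) (coDressKBmAt (ctr (d + 1) Lc) Lc (KInvStep (d := d) Lc l))) Lc Z)
        + (lin4 c (unitK (sfStep Lc l) (smStep d Lc l) (coDressKBmAt (ctr (d + 1) Lc) Lc (KInvStep (d := d) Lc l))) Lc Z
          - lin4 c (unitK (sfStep Lc l) (smStep d Lc l) (KInvStep (d := d) Lc l)) Lc Z) := by
    abel
  rw [e, eCell, eA, eE]
  exact (lin4_add_of_locStencil₂ hKl hδ₀ c Lc hDD hδD.le hEZ hδZ.le).symm

/-! ## §3 (C-6): the comb cells from the four divergence letter rows, uniformly in the level -/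

/-- **(C-6): THE COMB-CHART CELLS OF ANY FAMILY OF BI-TABLES ARE `LocStencil₂`, UNIFORMLY IN THE LEVEL, BY THE FOUR SINGLE-DIVERGENCE LETTER ROWS** [our bookkeeping; folklore
composition] (generic `d`, `2 ≤ Lc` for `0 < Lc` of the face calculus and `ctrOff ∈ box`; any `c`; DISPLAYED — EXACTLY the rows of MY g66 (E) `cell_rows_of_divergence_rows`, `hLc` for
`hr`: the undressed unit K-rows `hK` (uniform decay), the tables' shapes `hZ` (SOME, per `l`), and the four letter rows `h₂ h₁ hL₁ hL₂` with `l`-free constants at one rate `δ`):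
`∃ Ccell δcell, 0 ≤ Ccell ∧ 0 < δcell ∧ ∀ l, LocStencil₂ (lin4 c (unitK_l (GcombSh Lc l)) Lc (Z l) − lin4 c (unitK_l (KInvStep Lc l)) Lc (Z l)) Ccell δcell`, `δcell = min δK δ / 128`.
Route: §2 `comb_cell_eq_lin4_combDefect`; the comb defect table `𝔇 (𝒯₄ Z_l − Z_l) + (𝔇 Z_l − Z_l)` is `LocStencil₂` with an `l`-free constant at rate `δ` by
`PsiTableDefectOfDivergences.locStencil₂_psiTable_sub_self_of_divergence_rows` (the four-variable Ψ-defect from the four rows) ⨾ leaf-06's `locStencil₂_tableDress` PLUS MY g66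
FILE 1 `DressingDefectOfDivergences.locStencil₂_tableDress_sub_self_of_divergences` (the (E) defect from the same four rows); then leaf-18's `Lin4ZeroMode.locStencil₂_lin4`. -/
theorem comb_cell_rows_of_divergence_rows (hLc : 2 ≤ Lc) (c : ℝ) (Z : ℕ → Tab d) {CK δK : ℝ}
    (hK : ∀ j : ℕ, Decays (unitK (sfStep Lc j) (smStep d Lc j) (KInvStep (d := d) Lc j)) CK δK) (hδK : 0 < δK)
    {C₂ C₁ CL₁ CL₂ δ : ℝ} (hδ : 0 < δ)
    (hZ : ∀ l, ∃ CZ δZ : ℝ, 0 < δZ ∧ LocStencil₂ (Z l) CZ δZ)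
    (h₂ : ∀ l, LocStencil₂ (fun (κ : Fin (d + 1)) (u : Fin (d + 1) → ℤ) (_ : Fin (d + 1)) (p : Fin (d + 1) → ℤ) =>
      divV (fun κ₁ u₁ => Z l κ u κ₁ u₁) p) C₂ δ)
    (h₁ : ∀ l, LocStencil₂ (fun (_ : Fin (d + 1)) (p : Fin (d + 1) → ℤ) (κ' : Fin (d + 1)) (u' : Fin (d + 1) → ℤ) =>
      divV (fun κ₁ u₁ => Z l κ₁ u₁ κ' u') p) C₁ δ)
    (hL₁ : ∀ l, LocStencil₂ (fun κ u κ' u' => fun (p z : Fin (d + 1) → ℤ) (_ : Fib d) (b : Fib d) =>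
      ∑ β : Fin (d + 1), (Z l κ u κ' u' p z (Sum.inl β) b - Z l κ u κ' u' (p - unitVec β) z (Sum.inl β) b)) CL₁ δ)
    (hL₂ : ∀ l, LocStencil₂ (fun κ u κ' u' => fun (x p : Fin (d + 1) → ℤ) (a : Fib d) (_ : Fib d) =>
      ∑ β : Fin (d + 1), (Z l κ u κ' u' x p a (Sum.inl β) - Z l κ u κ' u' x (p - unitVec β) a (Sum.inl β))) CL₂ δ) :
    ∃ Ccell δcell : ℝ, 0 ≤ Ccell ∧ 0 < δcell ∧ ∀ l, LocStencil₂
      (lin4 c (unitK (sfStep Lc l) (smStep d Lc l) (GcombSh (d := d) Lc l)) Lc (Z l)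
        - lin4 c (unitK (sfStep Lc l) (smStep d Lc l) (KInvStep (d := d) Lc l)) Lc (Z l)) Ccell δcell := by
  have hLc1 : 1 ≤ Lc := le_trans (by norm_num) hLc
  have hLc0 : 0 < Lc := hLc1
  have hr : ctrOff (d + 1) Lc ∈ box (d + 1) Lc := ctrOff_mem_box hLc1
  have hCK : 0 ≤ CK := (hK 0).nonneg (Sum.inl 0)
  -- the four-variable Ψ-defect of each table from the four rows (`l`-free constant, rate `δ`), dressed (leaf-06, `l`-free factor)
  have hD := fun l => locStencil₂_psiTable_sub_self_of_divergence_rows hLc0 hr (Z l) hδ.le (h₁ l) (h₂ l) (hL₁ l) (hL₂ l)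
  have hDD := fun l => locStencil₂_tableDress hLc1 hr (hD l) hδ.le
  -- the (E) defect of each table from the same four rows (MY g66 FILE 1)
  have hE := fun l => locStencil₂_tableDress_sub_self_of_divergences hLc1 hr (Z l) hδ.le (h₂ l) (h₁ l) (hL₁ l) (hL₂ l)
  -- the comb defect table and its undressed `lin4`
  have hDc := fun l => locStencil₂_add' (hDD l) (hE l)
  have hA := fun l => locStencil₂_lin4 (hK l) hCK hδK hLc1 c (hDc l) hδ
  refine ⟨_, min δK δ / 128, (hA 0).nonneg, by positivity, fun l => ?_⟩
  obtain ⟨CZ, δZ, hδZ, hZl⟩ := hZ l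
  rw [comb_cell_eq_lin4_combDefect hLc c l hZl hδZ (hD l) hδ]
  exact hA l

end Summit.QuantumFields.BalabanUV.Beta.GAN24.CombHalfMemberCellOfDivergences

end
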